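import Mathlib
import Summits.Ventures.PercRepro2.GibbsPAq

/-!
# Positive association from a monotone Gibbs sampler — the joint-law form (blind cell PercRepro2,
p3 g12, 2026-08-27; `proofs/P3-G2.md` §3)

`GibbsPAq.cov_nonneg_of_gibbs` takes a kernel.  Here the kernel is BUILT from a joint law
`J : S → K → ℝ` on two finite types (the two explorations of `P3-G2.md` §2): the two-step
Gibbs kernel `gibbsKernel J s s' = ∑ k, (J s k / q s) · (J s' k / Q k)` with the marginals
`q s = ∑ k, J s k`, `Q k = ∑ s, J s k`, and the conditional expectations `condS J g k =
(∑ s, J s k * g s) / Q k`.  The law of total covariance in the form used twice in the paper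
(`cov_cond_le_cov`: the covariance of the conditional expectations is at most the covariance,
provided the conditional laws are positively associated on the pair) gives the
covariance-decreasing step, and `cov_nonneg_of_joint` packages the whole argument: a class `Inc`
on `S` and a class `IncK` on `K`, exchanged by the two conditional expectations, conditional
positive association on each side, and the minorisation `δ · q s' ≤ gibbsKernel J s s'` on the
support rows ⇒ every two functions of `Inc` are positively correlated under `q`.  Pure algebra
over finite sums; `Mathlib` + `GibbsPAq`; standard axioms.
-/

namespace Summit.Ventures.PercRepro2

namespace GibbsPAJoint

open Finset GibbsPAq

variable {S K : Type*} [Fintype S] [Fintype K]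

/-- The conditional expectation of `g : S → ℝ` given `k`, under the joint weights `J`
(`0` where the marginal vanishes, by the convention `x / 0 = 0`). -/
noncomputable def condS (J : S → K → ℝ) (g : S → ℝ) (k : K) : ℝ :=
  (∑ s, J s k * g s) / (∑ s, J s k)

/-- The transposed joint law. -/
def transpose (J : S → K → ℝ) : K → S → ℝ := fun k s => J s k

/-- The two-step Gibbs kernel `s → k → s'`. -/
noncomputable def gibbsKernel (J : S → K → ℝ) (s s' : S) : ℝ :=
  ∑ k, (J s k / ∑ k', J s k') * (J s' k / ∑ s'', J s'' k)

omit [Fintype K] in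
/-- A column of non-negative weights whose sum vanishes is identically zero. -/
theorem all_zero_of_sum_eq_zero {J : S → K → ℝ} (hJ0 : ∀ s k, 0 ≤ J s k) {k : K}
    (h : ∑ s, J s k = 0) (s : S) : J s k = 0 :=
  (Finset.sum_eq_zero_iff_of_nonneg (fun s _ => hJ0 s k)).mp h s (Finset.mem_univ s)

omit [Fintype S] in
/-- A row of non-negative weights whose sum vanishes is identically zero. -/
theorem all_zero_of_sum_eq_zero' {J : S → K → ℝ} (hJ0 : ∀ s k, 0 ≤ J s k) {s : S}
    (h : ∑ k, J s k = 0) (k : K) : J s k = 0 :=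
  (Finset.sum_eq_zero_iff_of_nonneg (fun k _ => hJ0 s k)).mp h k (Finset.mem_univ k)

omit [Fintype K] in
/-- `Q k · E[g | k] = ∑ s, J s k * g s`, in all cases. -/
theorem marg_mul_condS (J : S → K → ℝ) (hJ0 : ∀ s k, 0 ≤ J s k) (g : S → ℝ) (k : K) :
    (∑ s, J s k) * condS J g k = ∑ s, J s k * g s := by
  unfold condS
  by_cases hQ : ∑ s, J s k = 0
  · rw [hQ, zero_mul]
    symm
    apply Finset.sum_eq_zero
    intro s _
    rw [all_zero_of_sum_eq_zero hJ0 hQ s, zero_mul]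
  · rw [mul_div_cancel₀ _ hQ]

/-- The tower property: `∑ k, Q k · E[g | k] = ∑ s, q s · g s`. -/
theorem sum_marg_condS (J : S → K → ℝ) (hJ0 : ∀ s k, 0 ≤ J s k) (g : S → ℝ) :
    ∑ k, (∑ s, J s k) * condS J g k = ∑ s, (∑ k, J s k) * g s := by
  simp_rw [marg_mul_condS J hJ0 g]
  rw [Finset.sum_comm]
  apply Finset.sum_congr rfl
  intro s _
  rw [Finset.sum_mul]

/-- Conditional positive association on every fibre bounds the weighted sum of the products of the
conditional expectations by the weighted sum of the products. -/
theorem sum_marg_condS_mul_le (J : S → K → ℝ) (hJ0 : ∀ s k, 0 ≤ J s k) (g₁ g₂ : S → ℝ)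
    (hH : ∀ k, (∑ s, J s k * g₁ s) * (∑ s, J s k * g₂ s) ≤
      (∑ s, J s k * (g₁ s * g₂ s)) * (∑ s, J s k)) :
    ∑ k, (∑ s, J s k) * (condS J g₁ k * condS J g₂ k) ≤ ∑ s, (∑ k, J s k) * (g₁ s * g₂ s) := by
  have hterm : ∀ k, (∑ s, J s k) * (condS J g₁ k * condS J g₂ k) ≤ ∑ s, J s k * (g₁ s * g₂ s) := by
    intro k
    by_cases hQ : ∑ s, J s k = 0
    · rw [hQ, zero_mul]
      apply Finset.sum_nonneg
      intro s _
      rw [all_zero_of_sum_eq_zero hJ0 hQ s, zero_mul]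
    · have hQpos : 0 < ∑ s, J s k :=
        lt_of_le_of_ne (Finset.sum_nonneg (fun s _ => hJ0 s k)) (Ne.symm hQ)
      have e : (∑ s, J s k) * (condS J g₁ k * condS J g₂ k) =
          ((∑ s, J s k * g₁ s) * (∑ s, J s k * g₂ s)) / (∑ s, J s k) := by
        unfold condS
        field_simp
      rw [e, div_le_iff₀ hQpos]
      exact hH k
  calc ∑ k, (∑ s, J s k) * (condS J g₁ k * condS J g₂ k)
      ≤ ∑ k, ∑ s, J s k * (g₁ s * g₂ s) := Finset.sum_le_sum (fun k _ => hterm k)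
    _ = ∑ s, (∑ k, J s k) * (g₁ s * g₂ s) := by
        rw [Finset.sum_comm]
        apply Finset.sum_congr rfl
        intro s _
        rw [Finset.sum_mul]

/-- **Law of total covariance, inequality form**: if the conditional laws are positively associated
on `(g₁, g₂)`, the covariance of the conditional expectations is at most the covariance. -/
theorem cov_cond_le_cov (J : S → K → ℝ) (hJ0 : ∀ s k, 0 ≤ J s k) (g₁ g₂ : S → ℝ)
    (hH : ∀ k, (∑ s, J s k * g₁ s) * (∑ s, J s k * g₂ s) ≤
      (∑ s, J s k * (g₁ s * g₂ s)) * (∑ s, J s k)) :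
    cov (fun k => ∑ s, J s k) (condS J g₁) (condS J g₂) ≤ cov (fun s => ∑ k, J s k) g₁ g₂ := by
  unfold cov
  rw [sum_marg_condS J hJ0 g₁, sum_marg_condS J hJ0 g₂]
  have := sum_marg_condS_mul_le J hJ0 g₁ g₂ hH
  linarith

/-- The Gibbs kernel applied to `g` is the iterated conditional expectation. -/
theorem kap_gibbsKernel (J : S → K → ℝ) (g : S → ℝ) :
    kap (gibbsKernel J) g = condS (transpose J) (condS J g) := by
  funext s
  unfold kap gibbsKernel condS transpose
  rw [Finset.sum_div]
  have h1 : ∑ u, (∑ k, (J s k / ∑ k', J s k') * (J u k / ∑ s'', J s'' k)) * g u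
      = ∑ k, (J s k / ∑ k', J s k') * ((∑ u, J u k * g u) / ∑ s'', J s'' k) := by
    simp_rw [Finset.sum_mul]
    rw [Finset.sum_comm]
    apply Finset.sum_congr rfl
    intro k _
    rw [Finset.sum_div, Finset.mul_sum]
    apply Finset.sum_congr rfl
    intro u _
    ring
  rw [h1]
  apply Finset.sum_congr rfl
  intro k _
  ring

/-- The support rows of the Gibbs kernel are stochastic. -/
theorem sum_gibbsKernel (J : S → K → ℝ) (hJ0 : ∀ s k, 0 ≤ J s k) (s : S)
    (hs : ∑ k, J s k ≠ 0) : ∑ s', gibbsKernel J s s' = 1 := by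
  unfold gibbsKernel
  rw [Finset.sum_comm]
  have : ∀ k, ∑ s', (J s k / ∑ k', J s k') * (J s' k / ∑ s'', J s'' k) = J s k / ∑ k', J s k' := by
    intro k
    rw [← Finset.mul_sum, ← Finset.sum_div]
    by_cases hQ : ∑ s'', J s'' k = 0
    · rw [hQ, div_zero, mul_zero, all_zero_of_sum_eq_zero hJ0 hQ s, zero_div]
    · rw [div_self hQ, mul_one]
  simp_rw [this]
  rw [← Finset.sum_div, div_self hs]

/-- The support rows of the Gibbs kernel vanish off the support. -/
theorem gibbsKernel_eq_zero (J : S → K → ℝ) (hJ0 : ∀ s k, 0 ≤ J s k) (s s' : S)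
    (hs' : ∑ k, J s' k = 0) : gibbsKernel J s s' = 0 := by
  unfold gibbsKernel
  apply Finset.sum_eq_zero
  intro k _
  rw [all_zero_of_sum_eq_zero' hJ0 hs' k, zero_div, mul_zero]

/-- **Positive association from a joint law with a monotone Gibbs sampler.** -/
theorem cov_nonneg_of_joint (J : S → K → ℝ) (hJ0 : ∀ s k, 0 ≤ J s k)
    (hJ1 : ∑ s, ∑ k, J s k = 1)
    (Inc : (S → ℝ) → Prop) (IncK : (K → ℝ) → Prop)
    (hIS : ∀ g, Inc g → IncK (condS J g)) (hIK : ∀ F, IncK F → Inc (condS (transpose J) F))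
    (hHS : ∀ g₁ g₂, Inc g₁ → Inc g₂ → ∀ k, (∑ s, J s k * g₁ s) * (∑ s, J s k * g₂ s) ≤
      (∑ s, J s k * (g₁ s * g₂ s)) * (∑ s, J s k))
    (hHK : ∀ F₁ F₂, IncK F₁ → IncK F₂ → ∀ s, (∑ k, J s k * F₁ k) * (∑ k, J s k * F₂ k) ≤
      (∑ k, J s k * (F₁ k * F₂ k)) * (∑ k, J s k))
    (δ : ℝ) (hδ : 0 < δ)
    (hmin : ∀ s s', (∑ k, J s k) ≠ 0 → δ * (∑ k, J s' k) ≤ gibbsKernel J s s')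
    (g₁ g₂ : S → ℝ) (h₁ : Inc g₁) (h₂ : Inc g₂) : 0 ≤ cov (fun s => ∑ k, J s k) g₁ g₂ := by
  apply cov_nonneg_of_gibbs (fun s => ∑ k, J s k) (fun s => Finset.sum_nonneg (fun k _ => hJ0 s k))
    hJ1 (gibbsKernel J) δ hδ (fun s hs => sum_gibbsKernel J hJ0 s hs) hmin
    (fun s s' _ hs' => gibbsKernel_eq_zero J hJ0 s s' hs') Inc
  · intro g hg
    rw [kap_gibbsKernel]
    exact hIK _ (hIS _ hg)
  · intro g₁ g₂ hg₁ hg₂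
    rw [kap_gibbsKernel, kap_gibbsKernel]
    have step1 : cov (fun k => ∑ s, J s k) (condS J g₁) (condS J g₂) ≤
        cov (fun s => ∑ k, J s k) g₁ g₂ := cov_cond_le_cov J hJ0 g₁ g₂ (hHS g₁ g₂ hg₁ hg₂)
    have step2 : cov (fun s => ∑ k, transpose J k s) (condS (transpose J) (condS J g₁))
        (condS (transpose J) (condS J g₂)) ≤
        cov (fun k => ∑ s, transpose J k s) (condS J g₁) (condS J g₂) :=
      cov_cond_le_cov (transpose J) (fun k s => hJ0 s k) _ _
        (hHK _ _ (hIS g₁ hg₁) (hIS g₂ hg₂))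
    unfold transpose at step2
    exact le_trans step2 step1
  · exact h₁
  · exact h₂

end GibbsPAJoint

end Summit.Ventures.PercRepro2
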